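import Summits.ResolutionOfSingularities.ResolutionOfSingularities.Theorems.DeltaCutStellarJetRound

/-!
# δ-cut, stellar NC-HYP arm — «JetCut» §Star: the jet guard, the transport of the datum, the strategy law (T19b-iii)

[OURS · decomp-res-lens-6 g35 · column item `E1TopNoAbs` (stmt-ResolutionOfSingularities-26971)]  Third slice of the «JetCut»
round engine (plan: `Theorems/DeltaCutStellarJet.lean`): THE NEAR-POINT LEMMA (`JetAt.not_transform_le_sq`: over a point with a
jet datum and off `V(H')`, `𝓘' ⊄ 𝔪²` — the extended derivation sees `wᵖ·π^*(δ r)`, `p = 0` kills `δ'(wᵖ)`), THE DULL LEMMA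
(`ncHypShapeF.not_transform_le_sq_of_dull`), THE GUARD `supp M' ⊆ V(H')` for the jet shape under ANY face round of weight `≥ p`
(`ncHypShapeJet.support_transform_subset`: safe faces by T17b, unsafe faces by near-point/dull), THE TRANSPORT of the datum
(`JetAt.transform`), the round lemma along the strategy (`ncHypShapeJet.transform_star`),
`faceStableShapeStar_ncHypShapeJet : FaceStableShapeStar p (ncHypShapeJet p)` and the list-level law
`exists_weakResolution_of_ncHypShapeJet`.  0 sorry. [new] [cite: Hauser2010, §5] [cite: CossartPiltant2008, Prop. 4.2 (a)]
[cite: Kollar2007, (3.111) Step 3]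
-/
noncomputable section

open CategoryTheory CategoryTheory.Limits AlgebraicGeometry TopologicalSpace IsLocalRing
open Literature.AlgebraicGeometry.Resolution

namespace Summit.ResolutionOfSingularities.ResolutionOfSingularities.Theorems.DeltaCutClasses

open Summit.ResolutionOfSingularities.ResolutionOfSingularities.Theorems
open WeakOrderReduction ForcedTowerClasses

/-! ### §Star — guard, transport, strategy -/

section Round

variable {X X' : Scheme.{0}} [IsLocallyNoetherian X] {π : X' ⟶ X} {H : X.IdealSheafData}
  {E : List (X.IdealSheafData × ℕ)} {T : Finset X.IdealSheafData} {p : ℕ} {M : MarkedIdeal X}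

/-- **THE NEAR-POINT LEMMA (jet guard).**  At a point `x'` OFF `V(H')` lying over a point with a jet datum: `𝓘'_{x'} ⊄ 𝔪_{x'}²`
(module docstring; off the centre the statement is vacuous-free too: `ε = π^*h` still generates `C_y𝒪'`). [new] [cite: Hauser2010, §5] [cite: CossartPiltant2008, Prop. 4.2 (a)] -/
theorem JetAt.not_transform_le_sq (hEs : HasSNC (H :: boundaryOf E)) (hT : ∀ K ∈ T, K ∈ H :: boundaryOf E) (hHT : H ∈ T)
    (hπ : IsBlowup π (T.sup id)) (hpT : p ≤ weightOf E T) (hp : p.Prime) (hμ : M.mult = p) {x' : X'}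
    (hp0 : ((p : ℕ) : X'.presheaf.stalk x') = 0)
    (hx' : x' ∉ (strictTransformIdeal π (T.sup id) H).support) (hJ : JetAt p E H M.ideal (π x')) :
    ¬ stalkIdeal (M.transform π (T.sup id)).ideal x' ≤ maximalIdeal (X'.presheaf.stalk x') ^ 2 := by
  classical
  haveI : IsProper π := hπ.isProper
  haveI : IsLocallyNoetherian X' := LocallyOfFiniteType.isLocallyNoetherian π
  have hEs' : HasSNC (strictTransformIdeal π (T.sup id) H :: boundaryOf (transformExp E π T p)) :=
    hasSNC_ncShape_transform hEs hT hπ p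
  haveI : IsRegularLocalRing (X'.presheaf.stalk x') := (hEs' x').1
  haveI : IsDomain (X'.presheaf.stalk x') := isDomain_of_isRegularLocalRing _
  intro hle
  obtain ⟨h, m₀, r, δ, hδ, hHy, hm₀, hFI, hlog, hunit⟩ := hJ
  set φ := (π.stalkMap x').hom with hφ
  have hCmap : (stalkIdeal (T.sup id) (π x')).map φ = Ideal.span {φ h} :=
    map_stalkIdeal_finsetSup_eq_span_of_not_mem hEs hT hHT hπ hx' hHy
  have hFx : stalkIdeal ((T.sup id).comap π) x' = Ideal.span {φ h} := by
    rw [stalkIdeal_comap_eq_map_stalkMap, hCmap]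
  have hε0 : φ h ≠ 0 := by
    obtain ⟨ε, hε0, hε⟩ := exists_ne_zero_stalkIdeal_eq_span hEs' (comap_mem_frame_transform p) x'
    intro h0
    have : Ideal.span {ε} = ⊥ := by rw [← hε, hFx, h0, Ideal.span_singleton_eq_bot]
    exact hε0 (Ideal.span_singleton_eq_bot.mp this)
  -- `π^* m₀ = w·ε`
  have hm₀C : m₀ ∈ stalkIdeal (T.sup id) (π x') := mem_stalkIdeal_finsetSup_of_pow_mem hEs hT hpT hp.ne_zero hm₀
  obtain ⟨w, hw⟩ : ∃ w, w * φ h = φ m₀ :=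
    Ideal.mem_span_singleton'.mp (hCmap ▸ Ideal.mem_map_of_mem φ hm₀C)
  -- `G := 1 + π^*(r)·wᵖ ∈ 𝓘'_{x'}`
  have hG : 1 + φ r * w ^ p ∈ stalkIdeal (M.transform π (T.sup id)).ideal x' := by
    rw [MarkedIdeal.transform_ideal, hμ, hπ.stalkIdeal_controlledTransform, stalkIdeal_comap_eq_map_stalkMap, hFx,
      Ideal.span_singleton_pow, Ideal.mem_colon_span_singleton]
    have : (1 + φ r * w ^ p) * φ h ^ p = φ (h ^ p + r * m₀ ^ p) := by
      rw [map_add, map_pow, map_mul, map_pow, ← hw]; ring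
    rw [this]
    exact Ideal.mem_map_of_mem φ hFI
  -- the extended derivation sees the jet
  obtain ⟨δ', hδ', hcomm⟩ := exists_isDeriv_transform hEs hT hπ x' hδ fun K hK hyK g hg => hlog K (hT K hK) hyK g hg
  have hdG : δ' (1 + φ r * w ^ p) = w ^ p * φ (δ r) := by
    rw [hδ'.map_add, hδ'.map_one, hδ'.leibniz, hδ'.map_pow_eq_zero_of_natCast hp0, hcomm, mul_zero, zero_add, zero_add]
  have h𝔪 : w ^ p * φ (δ r) ∈ maximalIdeal (X'.presheaf.stalk x') := by
    rw [← hdG]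
    exact hδ'.apply_mem_of_mem_sq _ (hle hG)
  have hunit' : IsUnit (φ (δ r)) := hunit.map φ
  have hwp : w ^ p ∈ maximalIdeal (X'.presheaf.stalk x') :=
    ((Ideal.IsPrime.mul_mem_iff_mem_or_mem inferInstance).mp h𝔪).resolve_right fun h =>
      (mem_nonunits_iff.mp ((IsLocalRing.mem_maximalIdeal _).mp h)) hunit'
  have hw𝔪 : w ∈ maximalIdeal (X'.presheaf.stalk x') := Ideal.IsPrime.mem_of_pow_mem inferInstance p hwp
  have hG𝔪 : 1 + φ r * w ^ p ∈ maximalIdeal (X'.presheaf.stalk x') := Ideal.pow_le_self two_ne_zero (hle hG)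
  have h1 : (1 : X'.presheaf.stalk x') ∈ maximalIdeal (X'.presheaf.stalk x') := by
    have := Ideal.sub_mem _ hG𝔪 (Ideal.mul_mem_left _ (φ r) (Ideal.pow_mem_of_mem _ hw𝔪 p hp.pos))
    rwa [add_sub_cancel_right] at this
  exact (maximalIdeal.isMaximal _).ne_top (Ideal.eq_top_of_isUnit_mem _ h1 isUnit_one)

/-- **THE DULL LEMMA.**  If the face carries a member `K₀` of exponent `≥ p` and some member `K₁ ∉ T` of nonzero exponent passes
through `π x'`, then at `x'` over the centre and off `V(H')` the transform is trivial: `𝓜_y ⊆ C_yᵖ·𝔪_y`, so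
`𝓘'_{x'} ∋ 1 + (unit)·t` with `t ∈ 𝔪_{x'}`. [new] [cite: Kollar2007, (3.111) Step 3] -/
theorem ncHypShapeF.not_transform_le_sq_of_dull (hEs : HasSNC (H :: boundaryOf E)) (hT : ∀ K ∈ T, K ∈ H :: boundaryOf E)
    (hHT : H ∈ T) (hπ : IsBlowup π (T.sup id)) (hP : ncHypShapeF p X E H M)
    {K₀ : X.IdealSheafData} (hK₀T : K₀ ∈ T) (ha₀ : p ≤ expOf E K₀)
    {K₁ : X.IdealSheafData} (hK₁T : K₁ ∉ T) {x' : X'} (hyK₁ : π x' ∈ K₁.support) (ha₁ : expOf E K₁ ≠ 0)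
    (hxC : π x' ∈ (T.sup id).support) (hx' : x' ∉ (strictTransformIdeal π (T.sup id) H).support) :
    ¬ stalkIdeal (M.transform π (T.sup id)).ideal x' ≤ maximalIdeal (X'.presheaf.stalk x') ^ 2 := by
  classical
  haveI : IsProper π := hπ.isProper
  haveI : IsLocallyNoetherian X' := LocallyOfFiniteType.isLocallyNoetherian π
  have hEs' : HasSNC (strictTransformIdeal π (T.sup id) H :: boundaryOf (transformExp E π T p)) :=
    hasSNC_ncShape_transform hEs hT hπ p
  haveI : IsRegularLocalRing (X'.presheaf.stalk x') := (hEs' x').1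
  haveI : IsDomain (X'.presheaf.stalk x') := isDomain_of_isRegularLocalRing _
  intro hle
  have hyT : ∀ K ∈ T, π x' ∈ K.support := (mem_support_finsetSup_iff T _).mp hxC
  obtain ⟨h, m, u, -, hHy, hMy, hIy⟩ := hP.exists_generator (hyT H hHT)
  set φ := (π.stalkMap x').hom with hφ
  have hCmap : (stalkIdeal (T.sup id) (π x')).map φ = Ideal.span {φ h} :=
    map_stalkIdeal_finsetSup_eq_span_of_not_mem hEs hT hHT hπ hx' hHy
  have hFx : stalkIdeal ((T.sup id).comap π) x' = Ideal.span {φ h} := by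
    rw [stalkIdeal_comap_eq_map_stalkMap, hCmap]
  -- `𝓜_y ⊆ C_yᵖ · 𝔪_y`
  have hK₀₁ : K₀ ≠ K₁ := fun h => hK₁T (h ▸ hK₀T)
  have hMle : stalkIdeal (monomialIdeal E) (π x') ≤
      stalkIdeal (T.sup id) (π x') ^ p * maximalIdeal (X.presheaf.stalk (π x')) := by
    refine (stalkIdeal_monomialIdeal_le_pow_mul_pow E hK₀₁ (π x')).trans (Ideal.mul_mono ?_ ?_)
    · exact (Ideal.pow_le_pow_right ha₀).trans (Ideal.pow_right_mono (stalkIdeal_mono (Finset.le_sup (f := id) hK₀T) _) p)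
    · exact (Ideal.pow_le_self ha₁).trans ((mem_support_iff_stalkIdeal_le K₁ _).mp hyK₁)
  have hmC : φ m ∈ Ideal.span {φ h} ^ p * (maximalIdeal (X.presheaf.stalk (π x'))).map φ := by
    have hm : m ∈ stalkIdeal (monomialIdeal E) (π x') := by rw [hMy]; exact Ideal.mem_span_singleton_self m
    have := Ideal.mem_map_of_mem φ (hMle hm)
    rwa [Ideal.map_mul, Ideal.map_pow, hCmap] at this
  rw [Ideal.span_singleton_pow, Ideal.mem_span_singleton_mul] at hmC
  obtain ⟨t, ht, hmt⟩ := hmC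
  have ht𝔪 : t ∈ maximalIdeal (X'.presheaf.stalk x') := IsLocalRing.map_maximalIdeal_le φ ht
  -- `1 + π^*(u)·t ∈ 𝓘'_{x'}`
  have hG : 1 + φ u * t ∈ stalkIdeal (M.transform π (T.sup id)).ideal x' := by
    rw [MarkedIdeal.transform_ideal, hP.mult_eq, hπ.stalkIdeal_controlledTransform, stalkIdeal_comap_eq_map_stalkMap, hFx,
      Ideal.span_singleton_pow, Ideal.mem_colon_span_singleton]
    have : (1 + φ u * t) * φ h ^ p = φ (h ^ p + u * m) := by
      rw [map_add, map_pow, map_mul, ← hmt]; ring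
    rw [this]
    refine Ideal.mem_map_of_mem φ ?_
    rw [hIy]
    exact Ideal.mem_span_singleton_self _
  have hG𝔪 : 1 + φ u * t ∈ maximalIdeal (X'.presheaf.stalk x') := Ideal.pow_le_self two_ne_zero (hle hG)
  have h1 : (1 : X'.presheaf.stalk x') ∈ maximalIdeal (X'.presheaf.stalk x') := by
    have := Ideal.sub_mem _ hG𝔪 (Ideal.mul_mem_left _ (φ u) ht𝔪)
    rwa [add_sub_cancel_right] at this
  exact (maximalIdeal.isMaximal _).ne_top (Ideal.eq_top_of_isUnit_mem _ h1 isUnit_one)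

/-- ★ **THE GUARD `supp M' ⊆ V(H')` FOR THE JET SHAPE** under the blow-up of ANY face through `H` of weight `≥ p`: a safe face is
T17b; an unsafe face is tight with one member `K₁ ∈ T` of exponent `p` (all others `0`), and a point `x'` over the centre, off
`V(H')`, in the support would contradict the near-point lemma (`π x'` `p`-divisible) or the dull lemma (a member `∉ T` of
exponent prime to `p` through `π x'`). [new] [cite: CossartPiltant2008, Prop. 4.2 (a)] [cite: Hauser2010, §5] -/
theorem ncHypShapeJet.support_transform_subset (hEs : HasSNC (H :: boundaryOf E)) (hT : ∀ K ∈ T, K ∈ H :: boundaryOf E)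
    (hHT : H ∈ T) (hπ : IsBlowup π (T.sup id)) (hpT : p ≤ weightOf E T) (hP : ncHypShapeJet p X E H M) :
    (M.transform π (T.sup id)).support ⊆ ((strictTransformIdeal π (T.sup id) H).support : Set X') := by
  classical
  haveI : IsProper π := hπ.isProper
  haveI : IsLocallyNoetherian X' := LocallyOfFiniteType.isLocallyNoetherian π
  by_cases hsafe : SafeFace p X E T
  · exact hP.toF.support_transform_subset_of_safe hEs hT hHT hπ hpT hP.prime.two_le hsafe
  intro x' hx'
  have hx'' : x' ∈ (M.transform π (T.sup id)).support := hx'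
  by_cases hxC : π x' ∈ (T.sup id).support
  swap
  · exact mem_support_strictTransformIdeal_of_not_mem hxC
      (hP.toF.support_subset ((hπ.mem_support_transform_iff_of_not_mem M hxC).mp hx''))
  by_contra hxH
  have hle : stalkIdeal (M.transform π (T.sup id)).ideal x' ≤ maximalIdeal (X'.presheaf.stalk x') ^ 2 := by
    have h := (MarkedIdeal.mem_support_iff _ _).mp hx''
    rw [MarkedIdeal.transform_mult, hP.toF.mult_eq] at h
    exact h.trans (Ideal.pow_le_pow_right hP.prime.two_le)
  have hyT : ∀ K ∈ T, π x' ∈ K.support := (mem_support_finsetSup_iff T _).mp hxC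
  have hp0 : ((p : ℕ) : X'.presheaf.stalk x') = 0 := by
    have h := congrArg (π.stalkMap x').hom (hP.cast_eq_zero (π x'))
    rwa [map_natCast, map_zero] at h
  -- the unsafe face: tight, one member of exponent `p`
  rw [SafeFace] at hsafe
  push Not at hsafe
  obtain ⟨hW, -, K₁, hK₁T, y₁, hy₁, ha₁0, hnu⟩ := hsafe
  have hdvd₁ : p ∣ expOf E K₁ := by
    by_contra hnd
    exact hnu (isUnit_natCast_of_cast_prime_eq_zero hP.prime (hP.cast_eq_zero y₁) hnd)
  have ha₁p : expOf E K₁ = p := by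
    have hle₁ : expOf E K₁ ≤ weightOf E T := by
      rw [← sum_expOf_eq_weightOf]
      exact Finset.single_le_sum (fun _ _ => Nat.zero_le _) hK₁T
    have hge : p ≤ expOf E K₁ := Nat.le_of_dvd (Nat.pos_of_ne_zero ha₁0) hdvd₁
    omega
  have hothers : ∀ K ∈ T, K ≠ K₁ → expOf E K = 0 := fun K hK hne => by
    have h2 : expOf E K + expOf E K₁ ≤ weightOf E T := by
      rw [← sum_expOf_eq_weightOf, ← Finset.sum_pair hne]
      exact Finset.sum_le_sum_of_subset (Finset.insert_subset_iff.mpr ⟨hK, Finset.singleton_subset_iff.mpr hK₁T⟩)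
    omega
  by_cases hD : DivPt p E (π x')
  · exact (hP.jet (hyT H hHT) hD).not_transform_le_sq hEs hT hHT hπ hpT hP.prime hP.toF.mult_eq hp0 hxH hle
  · have hex : ∃ K', π x' ∈ K'.support ∧ ¬ p ∣ expOf E K' := by
      by_contra hno
      push Not at hno
      exact hD ⟨hno, K₁, hyT K₁ hK₁T, by rw [ha₁p]; exact hP.prime.ne_zero⟩
    obtain ⟨K', hyK', hnd⟩ := hex
    have ha'0 : expOf E K' ≠ 0 := fun h => hnd (by rw [h]; exact dvd_zero p)
    have hK'T : K' ∉ T := fun hK'T => by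
      by_cases hne : K' = K₁
      · exact hnd (by rw [hne]; exact hdvd₁)
      · exact ha'0 (hothers K' hK'T hne)
    exact hP.toF.not_transform_le_sq_of_dull hEs hT hHT hπ hK₁T (by rw [ha₁p]) hK'T hyK' ha'0 hxC hxH hle

/-- ★ **TRANSPORT OF THE JET DATUM** through the blow-up of a face through `H` of weight `≥ p`, at ANY point `x'` over a point
with a datum (module docstring: `h' = h₀·v`, `m₀' = m₁` with `π^*m₀ = m₁·ε`, `r' = π^*r`, `δ'` the chart extension).
[new] [cite: Kollar2007, (3.111) Step 3] [cite: StacksProject, Tag 0804] -/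
theorem JetAt.transform (hEs : HasSNC (H :: boundaryOf E)) (hT : ∀ K ∈ T, K ∈ H :: boundaryOf E) (hHT : H ∈ T)
    (hπ : IsBlowup π (T.sup id)) (hpT : p ≤ weightOf E T) (hp : p ≠ 0) (hμ : M.mult = p) (x' : X')
    (hJ : JetAt p E H M.ideal (π x')) :
    JetAt p (transformExp E π T p) (strictTransformIdeal π (T.sup id) H) (M.transform π (T.sup id)).ideal x' := by
  classical
  haveI : IsProper π := hπ.isProper
  haveI : IsLocallyNoetherian X' := LocallyOfFiniteType.isLocallyNoetherian π
  have hEs' : HasSNC (strictTransformIdeal π (T.sup id) H :: boundaryOf (transformExp E π T p)) :=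
    hasSNC_ncShape_transform hEs hT hπ p
  haveI : IsRegularLocalRing (X'.presheaf.stalk x') := (hEs' x').1
  haveI : IsDomain (X'.presheaf.stalk x') := isDomain_of_isRegularLocalRing _
  obtain ⟨h, m₀, r, δ, hδ, hHy, hm₀, hFI, hlog, hunit⟩ := hJ
  set φ := (π.stalkMap x').hom with hφ
  obtain ⟨h₀, -, hH₀⟩ := exists_ne_zero_stalkIdeal_eq_span hEs' List.mem_cons_self x'
  obtain ⟨ε, hε0, hε⟩ := exists_ne_zero_stalkIdeal_eq_span hEs' (comap_mem_frame_transform p) x'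
  have hCmap : (stalkIdeal (T.sup id) (π x')).map φ = Ideal.span {ε} := by
    rw [← stalkIdeal_comap_eq_map_stalkMap]; exact hε
  -- (a) `π^* h = h₀·ε·v₁`
  have ha : Ideal.span {h₀ * ε} = Ideal.span {φ h} := by
    have := map_stalkIdeal_eq_mul_of_mem hEs hT hπ hHT x'
    rw [hHy, Ideal.map_span, Set.image_singleton, hH₀, hε, Ideal.span_singleton_mul_span_singleton] at this
    exact this.symm
  obtain ⟨v₁, hv₁⟩ := Ideal.span_singleton_eq_span_singleton.mp ha
  -- (b) `π^* m₀ = m₁·ε`, `m₁ᵖ ∈ 𝓜(E')_{x'}`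
  have hm₀C : m₀ ∈ stalkIdeal (T.sup id) (π x') := mem_stalkIdeal_finsetSup_of_pow_mem hEs hT hpT hp hm₀
  obtain ⟨m₁, hm₁⟩ : ∃ m₁, m₁ * ε = φ m₀ :=
    Ideal.mem_span_singleton'.mp (hCmap ▸ Ideal.mem_map_of_mem φ hm₀C)
  have hm₁p : m₁ ^ p ∈ stalkIdeal (monomialIdeal (transformExp E π T p)) x' := by
    have h1 := Ideal.mem_map_of_mem φ hm₀
    rw [map_stalkIdeal_monomialIdeal_eq hEs hT hπ hpT x', hε, Ideal.span_singleton_pow, Ideal.mem_span_singleton_mul] at h1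
    obtain ⟨z, hz, hze⟩ := h1
    have : m₁ ^ p = z := mul_left_cancel₀ (pow_ne_zero p hε0) (by rw [hze, map_pow, ← hm₁]; ring)
    rw [this]
    exact hz
  -- (c) the extended derivation
  obtain ⟨δ', hδ', hcomm⟩ := exists_isDeriv_transform hEs hT hπ x' hδ fun K hK hyK g hg => hlog K (hT K hK) hyK g hg
  -- (d) the transformed equation
  have hG : (h₀ * ↑v₁) ^ p + φ r * m₁ ^ p ∈ stalkIdeal (M.transform π (T.sup id)).ideal x' := by
    rw [MarkedIdeal.transform_ideal, hμ, hπ.stalkIdeal_controlledTransform, stalkIdeal_comap_eq_map_stalkMap, hε,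
      Ideal.span_singleton_pow, Ideal.mem_colon_span_singleton]
    have : ((h₀ * ↑v₁) ^ p + φ r * m₁ ^ p) * ε ^ p = φ (h ^ p + r * m₀ ^ p) := by
      rw [map_add, map_pow, map_mul, map_pow, ← hv₁, ← hm₁]; ring
    rw [this]
    exact Ideal.mem_map_of_mem φ hFI
  -- (e) logarithmicity of `δ'` along the new frame
  have hlogC : ∀ g ∈ stalkIdeal (T.sup id) (π x'), δ g ∈ stalkIdeal (T.sup id) (π x') := by
    rw [stalkIdeal_finsetSup T (π x')]
    refine hδ.log_finsetSup T (fun K => stalkIdeal K (π x')) fun K hK g hg => ?_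
    by_cases hyK : π x' ∈ K.support
    · exact hlog K (hT K hK) hyK g hg
    · rw [stalkIdeal_eq_top_of_not_mem_support hyK]; exact Submodule.mem_top
  have hlogε : ∀ g ∈ Ideal.span {ε}, δ' g ∈ Ideal.span {ε} := by
    rw [← hCmap]
    exact fun g hg => hδ'.log_map φ hcomm hlogC hg
  have hstrict : ∀ K ∈ H :: boundaryOf E, x' ∈ (strictTransformIdeal π (T.sup id) K).support →
      ∀ g ∈ stalkIdeal (strictTransformIdeal π (T.sup id) K) x', δ' g ∈ stalkIdeal (strictTransformIdeal π (T.sup id) K) x' := by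
    intro K hK hxK
    have hyK : π x' ∈ K.support := mem_support_of_mem_support_strictTransformIdeal hxK
    have hlogK : ∀ g ∈ stalkIdeal K (π x'), δ g ∈ stalkIdeal K (π x') := hlog K hK hyK
    by_cases hKT : K ∈ T
    · have hmul := map_stalkIdeal_eq_mul_of_mem hEs hT hπ hKT x'
      rw [hε] at hmul
      intro g hg
      refine hδ'.log_of_log_mul hε0 (hlogε ε (Ideal.mem_span_singleton_self ε)) (fun x hx => ?_) hg
      rw [← hmul] at hx ⊢
      exact hδ'.log_map φ hcomm hlogK hx
    · intro g hg
      rw [← map_stalkIdeal_eq_of_not_mem hEs hT hπ hK hKT x'] at hg ⊢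
      exact hδ'.log_map φ hcomm hlogK hg
  refine ⟨h₀ * ↑v₁, m₁, φ r, δ', hδ', ?_, hm₁p, hG, ?_, ?_⟩
  · rw [hH₀, Ideal.span_singleton_mul_right_unit v₁.isUnit]
  · intro G hG' hxG
    rcases List.mem_cons.mp hG' with rfl | hG'
    · exact hstrict H List.mem_cons_self hxG
    · rw [boundaryOf_transformExp, List.mem_append, List.mem_map, List.mem_singleton] at hG'
      rcases hG' with ⟨K, hK, rfl⟩ | rfl
      · exact hstrict K (List.mem_cons_of_mem _ hK) hxG
      · rw [hε]; exact hlogε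
  · rw [hcomm]; exact hunit.map φ

/-- ★ **THE JET SHAPE SURVIVES A STRATEGY ROUND** (face of an `r`-set `T ∋ H` of weight `≥ p` in phase `r`, star bounds): the
unit-free part is T17a fed with the jet guard; `p = 0` moves along the stalk maps; the jet clause is transported
(`divPt_of_divPt_transform` + `JetAt.transform`). [new] [cite: Kollar2007, (3.111) Step 3] [cite: Hauser2010, §5] -/
theorem ncHypShapeJet.transform_star {r : ℕ} (hEs : HasSNC (H :: boundaryOf E)) (hT : ∀ K ∈ T, K ∈ H :: boundaryOf E)
    (hHT : H ∈ T) (hπ : IsBlowup π (T.sup id)) (hpT : p ≤ weightOf E T) (hTrH : T ∈ incSubsetsH E H r)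
    (hstar : StarBelowH E H p r) (hP : ncHypShapeJet p X E H M) :
    ncHypShapeJet p X' (transformExp E π T p) (strictTransformIdeal π (T.sup id) H) (M.transform π (T.sup id)) := by
  classical
  haveI : IsProper π := hπ.isProper
  haveI : IsLocallyNoetherian X' := LocallyOfFiniteType.isLocallyNoetherian π
  refine ⟨hP.toF.transform_of_support_subset hEs hT hHT hπ hpT (hP.support_transform_subset hEs hT hHT hπ hpT),
    hP.prime, fun x' => ?_, fun x' hx' hD => ?_⟩
  · have h := congrArg (π.stalkMap x').hom (hP.cast_eq_zero (π x'))
    rwa [map_natCast, map_zero] at h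
  · have hyH : π x' ∈ H.support := mem_support_of_mem_support_strictTransformIdeal hx'
    have hH0 : expOf E H = 0 := expOf_eq_zero_of_labels fun q hq hqH =>
      (hP.toF.label_eq_zero hq hqH).resolve_right (Set.nonempty_iff_ne_empty.mp ⟨π x', hyH⟩)
    have hDy : DivPt p E (π x') :=
      divPt_of_divPt_transform hEs hT hπ hpT hTrH hstar hH0 hP.prime.two_le hx' hD
    exact (hP.jet hyH hDy).transform hEs hT hHT hπ hpT hP.prime.ne_zero hP.toF.mult_eq x'

/-- ★ **THE JET SHAPE IS FACE-STABLE ALONG THE STRATEGY** (T16 `FaceStableShapeStar`). [new] -/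
theorem faceStableShapeStar_ncHypShapeJet (p : ℕ) : FaceStableShapeStar p (ncHypShapeJet p) where
  round _ _ _ _ T _ _ hEs _ hT hHT hmT hTrH hstar hP :=
    hP.transform_star hEs hT hHT (blowup.isBlowup (T.sup id)) hmT hTrH hstar
  face _ _ _ _ _ _ hEs hHT hmT hP := support_finsetSup_subset_support_ncHypShapeF hEs hHT hmT hP.toF
  terminal _ _ _ _ _ hEs _ hP h := support_ncHypShapeF_eq_empty (hasSNC_boundaryOf_of_cons hEs) hP.toF h

end Round

/-! ### §ListLaw — weak order reduction for the jet shape -/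

/-- ★★ **THE LIST-LEVEL «JetCut» LAW**: on a locally Noetherian scheme, a `ncHypShapeJet p`-datum for a labelled boundary `E ∋ H`
with `H :: E` s.n.c. admits a weak resolution (T16's strategy through `H`). [new] [cite: Kollar2007, (3.111) Step 3]
[cite: Hauser2010, §5] -/
theorem exists_weakResolution_of_ncHypShapeJet {p : ℕ} {X : Scheme.{0}} [IsLocallyNoetherian X]
    {E : List (X.IdealSheafData × ℕ)} {H : X.IdealSheafData} (hEs : HasSNC (H :: boundaryOf E)) (hH : H ∈ boundaryOf E)
    (M : MarkedIdeal X) (hP : ncHypShapeJet p X E H M) : ∃ s : CentreSeq X, WeakResolution s M :=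
  (faceStableShapeStar_ncHypShapeJet p).exists_weakResolution hEs hH M hP

end Summit.ResolutionOfSingularities.ResolutionOfSingularities.Theorems.DeltaCutClasses

end
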